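import Summits.QuantumFields.BalabanUV.T4Continuum.Support.NE7EtaBackgroundGaugeLetter
import Summits.QuantumFields.BalabanUV.T4Continuum.Support.TorusSmallFieldGlobalGauge

/-!
# NE7EtaBackgroundGaugeLetterDischarge — route #1 of the NE7 crux, stub S7 (NODE O, the BACKGROUND COORDINATE): the smooth-gauge LETTER
# `hletter` of `NE7EtaBackgroundBinders.hclose_of_refine_regular_letter` is now UNCONDITIONAL — the lattice lemma `torusSmallFieldGlobalGauge`
# (INTERFACE REQUEST NE7) is PROVED (`TorusSmallFieldGlobalGauge`, bricks B1–B4), so `hglob` of `hletter_of_torusGauge` (p259521) is discharged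

Cell `pub-balaban`, rung (B)+1 sub-cell t4, lineage `b2b-balaban-t4-ne7-p1`, generation 26 (CRUX PROVER NE7 #1, ruling e34b3e0c); crux
skeleton `t4/skeletons/NE7-CRUX-R1.md` v1.7.6 §3sexies ∕ §4 ∕ §5 (G5) item (3).  HONEST FRAMING (page 1): FIXED FINITE T⁴, rung (B)+1; NE7, NE3
NOT PRINTED in [Balaban1984PropagatorsI]–[Balaban1989LargeFieldII] and NOT PROVED here; continuum YM on T⁴ ⇐ BetaPertH ∧ nine spine estimates
(0/9 proved); BetaPertH ⇐ (D1) ∧ (D4) ∧ CAP+tail; G-an2-4 gates asym, D1 and NE2/3/4; NOT infinite volume, NOT mass gap, NOT Clay.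

WHAT ([folklore]; 0 def).
 * **`hletter_holds`**: the binder `hletter` of `hclose_of_refine_regular_letter` HOLDS with `σ_B := gaugeConst n · (N⁻¹ + N·b)` (K-free) under the
   displayed sector condition `|n|·N²·ε ≤ sectorConst n` — for EVERY `Regular 4 L N b g (K+1)` configuration (the minimiser hypothesis is idle):
   `hletter_of_torusGauge` ∘ `torusSmallFieldGlobalGauge_explicit`.
 * **`hclose_of_refine_regular`**: `NE7EtaBackgroundBinders.hclose_of_refine_regular_letter` with the letter DISCHARGED — the `hclose` binder of
   NODE O's background coordinate now costs EXACTLY: NE3's covariant root `h` (amendment 4), NE3's (H2)(H3) data (`h2`, `h3`), `hdom0`∕`hdom`, the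
   smallness letters, and the sector condition `hsector : |n|·N²·ε ≤ sectorConst n` (NEEDS-SIDE-CONDITION #S1, now with an EXPLICIT constant).
CONSEQUENCE FOR THE BILL (G5) item (3): CLOSED in kernel.  What remains of NODE O for route 1: the FUNCTIONAL half (T.2's Dch∕Φ∕N∕ϱ₀∕Ec + analyticity +
creation margin on the occurring backgrounds, (G5)(4)) and row NE3's own binders — unchanged.
HONEST: composition only; nothing of NE3∕NE7 discharged beyond the letter; 0 def; 0 sorry.
-/

set_option autoImplicit false

open scoped BigOperators Matrix Matrix.Norms.L2Operator
open Finset NormedSpace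

namespace Summit.QuantumFields.BalabanUV.T4Continuum.NE7EtaBackgroundGaugeLetterDischarge

open Literature.MathematicalPhysics.QuantumFieldTheory.Balaban1983to89
open B7Prop1Explicit B7Prop2Explicit
open T4AveragingDeficitWall hiding Site Plane Plaq Bond
open T4AveragingDeficitWallBoundary (periodBox IsPeriodicCfg)
open MinimalActionSandwich (IsMinimiser)
open MinimalActionRate (Regular sfClass)
open T4OutputRate (Carriers)
open AveragingDeficitPeriodicCounting (IsPeriodicDir)
open AveragingDeficitMultiLevelPrep (LevelSmall)
open NE3EnergyShapes (residualScale IsUnitarySite IsPeriodicSite)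
open NE3EnergyWeightedShapes (energyNormW)
open AveragingDeficitDualResidual (dualC1 dualC2)
open AveragingDeficitDerivWallProof (wallConst)
open NE7EtaBackgroundCarrier NE7EtaBackgroundCloseness
open NE7EtaBackgroundBinders (hclose_of_refine_regular_letter)
open TorusSmallFieldGlobalGauge (sectorConst gaugeConst sectorConst_pos torusSmallFieldGlobalGauge_explicit)
open NE7EtaBackgroundGaugeLetter (hletter_of_torusGauge)

noncomputable section

variable {n : Type} [Fintype n] [DecidableEq n] [Nonempty n]

/-- **THE LETTER HOLDS** (K-free `σ_B = gaugeConst n·(N⁻¹ + N·b)`, explicit sector constant `sectorConst n`): for every `K ≥ 1` and every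
`Regular 4 L N b g (K+1)` configuration `UB` (unitary, `N·L^{K+1}`-periodic, plaquettes within `b∕L^{2(K+1)}`), if `|n|·N²·ε ≤ sectorConst n` and
`0 ≤ b ≤ ε`, there is a unitary `N·L^{K+1}`-periodic gauge in which `UB` is bondwise `exp A_B` with `‖A_B‖ ≤ σ_B·θ^{6(K+1)}`. [folklore] -/
theorem hletter_holds {L N : ℕ} (hL : 2 ≤ L) (hN : 1 ≤ N) {θ : ℝ} (hθ6 : θ ^ 6 = ((L : ℝ))⁻¹) {ε b g : ℝ} (hb : 0 ≤ b) (hbε : b ≤ ε)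
    {dom : Set (Site 4 → Fin 4 → (Matrix n n ℂ)ˣ)} :
    ∀ K : ℕ, 1 ≤ K → ∀ v ∈ dom, ∀ UB : Site 4 → Fin 4 → (Matrix n n ℂ)ˣ,
      IsMinimiser 4 (sfClass 4 L N ε) L N (K + 1) v UB → Regular 4 L N b g (K + 1) UB →
        (Fintype.card n : ℝ) * (N : ℝ) ^ 2 * ε ≤ sectorConst n →
        ∃ uB : Site 4 → (Matrix n n ℂ)ˣ, IsUnitarySite uB ∧ IsPeriodicSite uB ((N * L ^ (K + 1) : ℕ) : ℤ) ∧
          ∃ AB : Site 4 → Fin 4 → Matrix n n ℂ, ∀ (x : Site 4) (κ : Fin 4),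
            ((gaugeAct uB UB x κ : (Matrix n n ℂ)ˣ) : Matrix n n ℂ) = exp (AB x κ) ∧
              ‖AB x κ‖ ≤ (gaugeConst n * (((N : ℝ))⁻¹ + (N : ℝ) * b)) * θ ^ (6 * (K + 1)) :=
  hletter_of_torusGauge hL hN hθ6 hb hbε (fun _ hM _ hη hsec _ hU hP hS => torusSmallFieldGlobalGauge_explicit hM hη hsec hU hP hS)

/-- **NODE O's `hclose` BINDER WITH THE LETTER DISCHARGED**: `NE7EtaBackgroundBinders.hclose_of_refine_regular_letter` (p259117) composed with
`hletter_holds` — the `hclose`∕`hδ` binders of `T4TowerRateComposition.uRateUpTo_tower` on the occurring-background carrier now cost EXACTLY row NE3's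
covariant root `h` (amendment 4), row NE3's (H2)(H3) data `h2`∕`h3`, the domain letters `hdom0`∕`hdom`, the smallness letters, `0 ≤ b ≤ ε`, and the
sector condition `|n|·N²·ε ≤ sectorConst n` (NEEDS-SIDE-CONDITION #S1 with an explicit constant); `σ_B = gaugeConst n·(N⁻¹ + N·b)`. [folklore] -/
theorem hclose_of_refine_regular {L N : ℕ} (hL : 2 ≤ L) (hN : 1 ≤ N) {θ : ℝ} (hθ : 0 < θ)
    (hθ6 : θ ^ 6 = ((L : ℝ))⁻¹) {ε : ℝ} (hε : 0 ≤ ε) (hε1 : 16 * C0 4 * ε ≤ 3)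
    (hε2 : 1024 * (4 + 1) * (4 + 4) * (L : ℝ) ^ 2 * ε ≤ 1) (hls : ∀ j : ℕ, LevelSmall 4 L j (ε / ((L : ℝ) ^ (j + 1)) ^ 2))
    {b g C Λ₁ Λ₂' : ℝ} (hb : 0 ≤ b) (hbε : b ≤ ε) (hbs : 512 * (4 + 1) * (4 + 4) * (L : ℝ) ^ 2 * b ≤ 1) (hg : 0 ≤ g) (hC : 0 ≤ C)
    (hΛ₂' : 0 < Λ₂') {dom : Set (Site 4 → Fin 4 → (Matrix n n ℂ)ˣ)} (hdom0 : dom ⊆ sfClass 4 L N ε 0)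
    (hdom : ∀ v ∈ dom, ∀ w : Site 4 → (Matrix n n ℂ)ˣ, IsUnitarySite w → IsPeriodicSite w (N : ℤ) → gaugeAct w v ∈ dom)
    (h2 : ∀ V ∈ dom, ∀ (k : ℕ) (U : Site 4 → Fin 4 → (Matrix n n ℂ)ˣ), IsMinimiser 4 (sfClass 4 L N ε) L N k V U →
      ∃ Ut, Ut ∈ sfClass 4 L N ε (k + 1) ∧ rescale L (bavg L Ut) = U)
    (h3 : ∀ V ∈ dom, ∀ (k : ℕ) (U : Site 4 → Fin 4 → (Matrix n n ℂ)ˣ),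
      IsMinimiser 4 (sfClass 4 L N ε) L N (k + 1) V U → Regular 4 L N b g (k + 1) U)
    (h : ∀ k : ℕ, 1 ≤ k → ∀ V ∈ dom, ∀ UA UB : Site 4 → Fin 4 → (Matrix n n ℂ)ˣ,
      IsMinimiser 4 (sfClass 4 L N ε) L N k V UA → IsMinimiser 4 (sfClass 4 L N ε) L N (k + 1) V UB →
        Regular 4 L N b g (k + 1) UB →
        ∃ (u : Site 4 → (Matrix n n ℂ)ˣ) (Z : Site 4 → Fin 4 → Matrix n n ℂ),
          IsUnitarySite u ∧ IsPeriodicSite u ((N * L ^ k : ℕ) : ℤ) ∧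
          IsSkewDir Z ∧ IsPeriodicDir Z ((N * L ^ k : ℕ) : ℤ) ∧
          gaugeAct u UA = vary (rescale L (bavg L UB)) Z 1 ∧
          energyNormW L k (rescale L (bavg L UB)) Z (periodBox (N * L ^ k)) ≤ C * residualScale 4 L N b g k ∧
          (∀ (κ : Fin 4) (x : Site 4) (μ : Fin 4),
            ‖Ad (rescale L (bavg L UB) (x + e κ) μ) (Z (x + e μ) κ) - Z x κ‖ ≤ Λ₁ * (((L : ℝ)⁻¹) ^ k) ^ 2) ∧
          (∀ (κ μ : Fin 4) (y : Site 4),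
            ‖Ad (rescale L (bavg L UB) (y + e κ) μ)
                (Ad (rescale L (bavg L UB) (y + e κ + e μ) μ) (Z (y + (2 : ℕ) • e μ) κ) - Z (y + e μ) κ)
              - (Ad (rescale L (bavg L UB) (y + e κ) μ) (Z (y + e μ) κ) - Z y κ)‖ ≤ Λ₂' * (((L : ℝ)⁻¹) ^ k) ^ 3))
    {γ l₁ : ℝ} (hγ : 0 < γ)
    (hγ3 : C * (wallConst 4 L * (N : ℝ) ^ 2 * (Real.sqrt g * dualC2 4 L + 2 * b ^ 2 * dualC1 4 L)) ≤ γ ^ 3)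
    (hl₁ : 0 < l₁) (hΛl₁ : Λ₁ ≤ l₁ ^ 3)
    (hsector : (Fintype.card n : ℝ) * (N : ℝ) ^ 2 * ε ≤ sectorConst n)
    (D : Type) (sc : D → ℕ) (dl : D → ℝ) (hdl : ∀ X, 0 ≤ dl X) :
    ∃ (uA : ℕ → (Site 4 → Fin 4 → (Matrix n n ℂ)ˣ) → (occCarriers n L N ε dom D sc dl hdl).BgA)
      (uB : ℕ → (Site 4 → Fin 4 → (Matrix n n ℂ)ˣ) → (occCarriers n L N ε dom D sc dl hdl).BgB) (K₀ : ℕ) (C₃ : ℝ),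
      0 ≤ C₃ ∧
      (∀ K : ℕ, K₀ ≤ K → ∀ v ∈ dom, ∃ (UA UB : Site 4 → Fin 4 → (Matrix n n ℂ)ˣ) (wA wB : Site 4 → (Matrix n n ℂ)ˣ),
        IsMinimiser 4 (sfClass 4 L N ε) L N K v UA ∧ IsMinimiser 4 (sfClass 4 L N ε) L N (K + 1) v UB ∧
        Regular 4 L N b g (K + 1) UB ∧ IsUnitarySite wA ∧ IsPeriodicSite wA ((N * L ^ K : ℕ) : ℤ) ∧
        IsUnitarySite wB ∧ IsPeriodicSite wB ((N * L ^ (K + 1) : ℕ) : ℤ) ∧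
        (uA K v).1 = (K, gaugeAct wA UA) ∧ (uB K v).1 = (K, gaugeAct wB UB)) ∧
      (∀ (K : ℕ) (v : Site 4 → Fin 4 → (Matrix n n ℂ)ˣ), ¬ (K₀ ≤ K ∧ v ∈ dom) →
        (uA K v).1 = (K, 1) ∧ (uB K v).1 = (K, 1)) ∧
      ∀ K : ℕ, ∀ v ∈ dom, (occCarriers n L N ε dom D sc dl hdl).gauge (uA K v)
          ((occCarriers n L N ε dom D sc dl hdl).transport (uB K v))
        ≤ C₃ * θ ^ K := by
  have hN0 : (0 : ℝ) < N := by exact_mod_cast hN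
  have hσB : 0 ≤ gaugeConst n * (((N : ℝ))⁻¹ + (N : ℝ) * b) := by
    have := (sectorConst_pos (n := n)).2
    positivity
  exact hclose_of_refine_regular_letter hL hN hθ hθ6 hε hε1 hε2 hls hb hbs hg hC hΛ₂' hdom0 hdom h2 h3 h hγ hγ3 hl₁ hΛl₁ hσB hsector
    (hletter_holds hL hN hθ6 hb hbε) D sc dl hdl

end

end Summit.QuantumFields.BalabanUV.T4Continuum.NE7EtaBackgroundGaugeLetterDischarge
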